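import Summits.AnomalousDissipation.AnomalousDissipation.Theorems.ScalarAnomalySteadySourceFormal.Negative.ColdStartCeiling
import Summits.AnomalousDissipation.AnomalousDissipation.Theorems.ScalarAnomalySteadySourceFormal.Negative.ScalarTimeShift
import HarnessLib

/-!
# Candidate proof of `stub_coldStartVariance` (S2 of line `budgeted-mixer-template`,
crux `TwoAndHalfD.ScalarAnomalySteadySourceFormal`, stmt-AnomalousDissipation-0448)

drefute seat — NOT landed by the refuter (stubs are the lead's to land); attached as item
evidence. The statement below is the registered stub signature VERBATIM (skeleton sha
7c4ef97a32c5). Proof = the line card's restart argument, over the landed support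
`Negative.ColdStartCeiling` (forced `L²` balance, sharp cold-start bound) and
`Negative.ScalarTimeShift` (global existence on `Ici 0`, releases on any window, linearity).
-/

open MeasureTheory Set Filter
open _root_.Topology
open scoped InnerProductSpace

noncomputable section

namespace Summit.AnomalousDissipation.AnomalousDissipation.Theorems.ScalarAnomalySteadySourceFormal.Negative

open Literature.Analysis Literature.Analysis.FunctionSpaces Literature.Analysis.FunctionSpaces.Torus
open Literature.Analysis.FluidPDE Literature.Analysis.FluidPDE.Torus

set_option linter.dupNamespace false

variable {d : Type*} [Fintype d] [DecidableEq d]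

omit [DecidableEq d] in
/-- Minkowski for `scalarL2Sq` on smooth slices: `√‖f + g‖² ≤ √‖f‖² + √‖g‖²`. [folklore] -/
theorem sqrt_scalarL2Sq_add_le {f g : UnitAddTorus d → ℝ} (hf : IsSmooth f) (hg : IsSmooth g) :
    Real.sqrt (scalarL2Sq (fun x => f x + g x)) ≤ Real.sqrt (scalarL2Sq f) + Real.sqrt (scalarL2Sq g) := by
  set F := Real.sqrt (scalarL2Sq f) with hF
  set G := Real.sqrt (scalarL2Sq g) with hG
  have hF0 : 0 ≤ F := Real.sqrt_nonneg _
  have hG0 : 0 ≤ G := Real.sqrt_nonneg _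
  have hFsq : F ^ 2 = scalarL2Sq f := Real.sq_sqrt (scalarL2Sq_nonneg f)
  have hGsq : G ^ 2 = scalarL2Sq g := Real.sq_sqrt (scalarL2Sq_nonneg g)
  have hcs : ∫ x, f x * g x ≤ F * G := integral_mul_le_sqrt_scalarL2Sq hf hg
  have i1 : Integrable (fun x => f x ^ 2) volume :=
    (hf.smul' hf).integrable.congr (ae_of_all _ fun x => by simp only [smul_eq_mul, sq])
  have i2 : Integrable (fun x => g x ^ 2) volume :=
    (hg.smul' hg).integrable.congr (ae_of_all _ fun x => by simp only [smul_eq_mul, sq])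
  have i3 : Integrable (fun x => 2 * (f x * g x)) volume :=
    ((hf.smul' hg).integrable.congr (ae_of_all _ fun x => by simp only [smul_eq_mul])).const_mul 2
  have i13 : Integrable (fun x => f x ^ 2 + 2 * (f x * g x)) volume := i1.add i3
  have hexp : scalarL2Sq (fun x => f x + g x) = scalarL2Sq f + 2 * (∫ x, f x * g x) + scalarL2Sq g := by
    simp only [scalarL2Sq]
    have hpt : (fun x => (f x + g x) ^ 2) = fun x => f x ^ 2 + 2 * (f x * g x) + g x ^ 2 := by
      funext x; ring
    rw [hpt, integral_add i13 i2, integral_add i1 i3, integral_const_mul]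
  have hle : scalarL2Sq (fun x => f x + g x) ≤ (F + G) ^ 2 := by
    have hsq : (F + G) ^ 2 = F ^ 2 + 2 * (F * G) + G ^ 2 := by ring
    rw [hexp, ← hFsq, ← hGsq, hsq]
    linarith [hcs]
  calc Real.sqrt (scalarL2Sq (fun x => f x + g x)) ≤ Real.sqrt ((F + G) ^ 2) := Real.sqrt_le_sqrt hle
    _ = F + G := Real.sqrt_sq (by positivity)

/-- **`stub_coldStartVariance` (S2) — candidate proof, registered signature verbatim.**
Restart argument: global cold start by `exists_isClassicalScalarTransportForcedOn_Ici`; on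
`[0, τ]` the cold-start bound `‖θ(r)‖ ≤ r‖h‖`; at `t' = t - τ ≥ 0` split `θ = φ + ρ` on
`[t', t]` with `φ` the release of `θ(t') ∈ S` (`exists_isClassicalScalarTransportOn_Icc`, (Half) via
(Inv-h)) and `ρ` the cold start at `t'` (`forced_sub_unforced`, `coldStart_scalarL2Sq_le`), so
`‖θ(t)‖ ≤ ½‖θ(t')‖ + τ‖h‖`; induction on `⌊t/τ⌋₊` gives `‖θ(t)‖ ≤ 2τ‖h‖`. [folklore] -/
theorem stub_coldStartVariance_proof :
    ∀ (κ τ : ℝ) (u : ℝ → UnitAddTorus (Fin 2) → EuclideanSpace ℝ (Fin 2))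
      (h : UnitAddTorus (Fin 2) → ℝ) (S : Set (UnitAddTorus (Fin 2) → ℝ)),
      0 < κ → 0 < τ →
      Torus.IsSmoothSpaceTimeOn (Set.Ici 0) u → (∀ t ∈ Set.Ici (0 : ℝ), Torus.IsDivFree (u t)) →
      Torus.IsSmooth h →
      (∀ (s : ℝ), 0 ≤ s → ∀ φ : ℝ → UnitAddTorus (Fin 2) → ℝ,
          Torus.IsClassicalScalarTransportOn (Set.Icc s (s + τ)) κ u φ → φ s ∈ S →
          Torus.scalarL2Sq (φ (s + τ)) ≤ 4⁻¹ * Torus.scalarL2Sq (φ s)) →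
      (∀ (θ : ℝ → UnitAddTorus (Fin 2) → ℝ),
          Torus.IsClassicalScalarTransportForcedOn (Set.Ici 0) κ u (fun _ => h) θ →
          θ 0 = (fun _ => (0 : ℝ)) → ∀ t, 0 ≤ t → θ t ∈ S) →
      ∃ θ : ℝ → UnitAddTorus (Fin 2) → ℝ,
        Torus.IsClassicalScalarTransportForcedOn (Set.Ici 0) κ u (fun _ => h) θ ∧
        θ 0 = (fun _ => (0 : ℝ)) ∧
        ∀ t, 0 ≤ t → Torus.scalarL2Sq (θ t) ≤ 4 * τ ^ 2 * Torus.scalarL2Sq h := by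
  intro κ τ u h S hκ hτ hu hdiv hh hHalf hInvh
  obtain ⟨θ, hθ, hθ0⟩ := exists_isClassicalScalarTransportForcedOn_Ici hκ hu hdiv
    (isSmoothSpaceTimeOn_const hh _) (isSmooth_const (0 : ℝ))
  refine ⟨θ, hθ, hθ0, ?_⟩
  have hS : ∀ t, 0 ≤ t → θ t ∈ S := hInvh θ hθ hθ0
  set N : ℝ := Real.sqrt (scalarL2Sq h) with hN
  have hN0 : 0 ≤ N := Real.sqrt_nonneg _
  have hNsq : N ^ 2 = scalarL2Sq h := Real.sq_sqrt (scalarL2Sq_nonneg h)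
  -- cold start from time `a ≥ 0` over one window: `‖ρ(a + τ)‖ ≤ τ N`, and the base window
  have hbase : ∀ t, 0 ≤ t → t ≤ τ → Real.sqrt (scalarL2Sq (θ t)) ≤ τ * N := by
    intro t ht0 htτ
    have hwin : IsClassicalScalarTransportForcedOn (Icc 0 τ) κ u (fun _ => h) θ :=
      forced_restrict_Icc hθ hτ Icc_subset_Ici_self
    have hsq := coldStart_scalarL2Sq_le hκ.le hτ hwin hθ0 t ⟨ht0, htτ⟩
    rw [sub_zero] at hsq
    calc Real.sqrt (scalarL2Sq (θ t)) ≤ Real.sqrt (t ^ 2 * scalarL2Sq h) := Real.sqrt_le_sqrt hsq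
      _ = t * N := by rw [Real.sqrt_mul (sq_nonneg _), Real.sqrt_sq ht0]
      _ ≤ τ * N := mul_le_mul_of_nonneg_right htτ hN0
  -- the restart step
  have hstep : ∀ t', 0 ≤ t' →
      Real.sqrt (scalarL2Sq (θ (t' + τ))) ≤ 2⁻¹ * Real.sqrt (scalarL2Sq (θ t')) + τ * N := by
    intro t' ht'
    have hlt : t' < t' + τ := by linarith
    have hIcc : Icc t' (t' + τ) ⊆ Ici (0 : ℝ) := fun r hr => le_trans ht' hr.1
    have hU : UniqueDiffOn ℝ (Icc t' (t' + τ)) := uniqueDiffOn_Icc hlt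
    have hθw : IsClassicalScalarTransportForcedOn (Icc t' (t' + τ)) κ u (fun _ => h) θ :=
      forced_restrict_Icc hθ hlt hIcc
    have hθt' : IsSmooth (θ t') := hθ.smooth_scalar.isSmooth_slice (show t' ∈ Ici (0:ℝ) from ht')
    -- the release `φ` of `θ(t')`
    obtain ⟨φ, hφ, hφ0⟩ := exists_isClassicalScalarTransportOn_Icc hκ hlt (hu.mono hIcc)
      (fun r hr => hdiv r (hIcc hr)) hθt'
    have hhalf : scalarL2Sq (φ (t' + τ)) ≤ 4⁻¹ * scalarL2Sq (θ t') := by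
      have := hHalf t' ht' φ hφ (by rw [hφ0]; exact hS t' ht')
      rwa [hφ0] at this
    -- the cold start `ρ = θ - φ` at `t'`
    have hρ : IsClassicalScalarTransportForcedOn (Icc t' (t' + τ)) κ u (fun _ => h)
        (fun r x => θ r x - φ r x) := forced_sub_unforced hU hθw hφ
    have hρ0 : (fun r x => θ r x - φ r x) t' = fun _ => 0 := by
      funext x
      simp [hφ0]
    have hρsq := coldStart_scalarL2Sq_le hκ.le hlt hρ hρ0 (t' + τ) ⟨hlt.le, le_rfl⟩
    have hρsq' : scalarL2Sq (fun x => θ (t' + τ) x - φ (t' + τ) x) ≤ τ ^ 2 * scalarL2Sq h := by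
      simpa using hρsq
    -- Minkowski on `θ(t) = φ(t) + ρ(t)`
    have hφs : IsSmooth (φ (t' + τ)) := hφ.smooth_scalar.isSmooth_slice ⟨hlt.le, le_rfl⟩
    have hθs : IsSmooth (θ (t' + τ)) := hθ.smooth_scalar.isSmooth_slice (hIcc ⟨hlt.le, le_rfl⟩)
    have hρs : IsSmooth (fun x => θ (t' + τ) x - φ (t' + τ) x) := hθs.sub hφs
    have hsum : (fun x => φ (t' + τ) x + (θ (t' + τ) x - φ (t' + τ) x)) = θ (t' + τ) := by
      funext x; ring
    have hmink := sqrt_scalarL2Sq_add_le hφs hρs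
    rw [hsum] at hmink
    have h1 : Real.sqrt (scalarL2Sq (φ (t' + τ))) ≤ 2⁻¹ * Real.sqrt (scalarL2Sq (θ t')) := by
      calc Real.sqrt (scalarL2Sq (φ (t' + τ))) ≤ Real.sqrt (4⁻¹ * scalarL2Sq (θ t')) :=
            Real.sqrt_le_sqrt hhalf
        _ = 2⁻¹ * Real.sqrt (scalarL2Sq (θ t')) := by
            rw [Real.sqrt_mul (by norm_num), show (4⁻¹ : ℝ) = (2⁻¹) ^ 2 by norm_num,
              Real.sqrt_sq (by norm_num)]
    have h2 : Real.sqrt (scalarL2Sq (fun x => θ (t' + τ) x - φ (t' + τ) x)) ≤ τ * N := by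
      calc Real.sqrt (scalarL2Sq (fun x => θ (t' + τ) x - φ (t' + τ) x))
            ≤ Real.sqrt (τ ^ 2 * scalarL2Sq h) := Real.sqrt_le_sqrt hρsq'
        _ = τ * N := by rw [Real.sqrt_mul (sq_nonneg _), Real.sqrt_sq hτ.le]
    linarith
  -- induction on the window count
  have hclaim : ∀ k : ℕ, ∀ t, 0 ≤ t → t ≤ ((k : ℝ) + 1) * τ →
      Real.sqrt (scalarL2Sq (θ t)) ≤ 2 * τ * N := by
    intro k
    induction k with
    | zero =>
      intro t ht0 ht1
      have := hbase t ht0 (by simpa using ht1)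
      nlinarith
    | succ k ih =>
      intro t ht0 ht1
      by_cases hle : t ≤ ((k : ℝ) + 1) * τ
      · exact ih t ht0 hle
      · push Not at hle
        have hk0 : (0 : ℝ) ≤ k := Nat.cast_nonneg k
        have ht'0 : 0 ≤ t - τ := by nlinarith
        have ht'1 : t - τ ≤ ((k : ℝ) + 1) * τ := by
          push_cast at ht1
          linarith
        have hih := ih (t - τ) ht'0 ht'1
        have hst := hstep (t - τ) ht'0
        rw [sub_add_cancel] at hst
        linarith
  intro t ht
  have hk : t ≤ ((⌊t / τ⌋₊ : ℝ) + 1) * τ := by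
    have h1 : t / τ < (⌊t / τ⌋₊ : ℝ) + 1 := Nat.lt_floor_add_one (t / τ)
    have h2 : t = t / τ * τ := by field_simp
    nlinarith
  have hfin := hclaim ⌊t / τ⌋₊ t ht hk
  have h0 : 0 ≤ Real.sqrt (scalarL2Sq (θ t)) := Real.sqrt_nonneg _
  calc scalarL2Sq (θ t) = Real.sqrt (scalarL2Sq (θ t)) ^ 2 := (Real.sq_sqrt (scalarL2Sq_nonneg _)).symm
    _ ≤ (2 * τ * N) ^ 2 := by gcongr
    _ = 4 * τ ^ 2 * scalarL2Sq h := by rw [← hNsq]; ring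

end Summit.AnomalousDissipation.AnomalousDissipation.Theorems.ScalarAnomalySteadySourceFormal.Negative

end
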